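import Mathlib
import Summits.KontsevichZagierPeriods.Zeta5Search.FourthOrderFrame
import HarnessLib

/-!
# ζ(5) search — the SHAPE THEOREM for frame functionals (tools for THEOREM L5, `SecondResidueLaw.LawA5`)

Cell `pub-zeta5` (HONEST FRAMING: systematic search; no irrationality claim unless certified), typer seat generation 13.
REPORT-gen2-g14 §2 (Lemma Tr, "T-shapes") made uniform.  A type `S = (L', f)` DOMINATES the frame type `T = (L, e)` at
offset `a` if `a + L ≤ L'` and `f m ≥ ẽ m` for every level `m ≤ L'`, where `ẽ = coreExt L a e` is `e` moved to the core levels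
`a..a+L` and `0` outside (every T-shape of degree `k` — `isRaiseN k T S` — is such an `S`, with `Σ_m (f m − ẽ m) = k`).  Then the
class function of `S` is `Φ_S(η) = P(η − a)·Φ_T(η − a)` with the EXPLICIT monic polynomial
`P = shapePoly = ∏_{m ≤ L'} (X − (m − a))^{f m − ẽ m}` (roots at the raised levels, in T-coordinates), and consequently:
* `X_pow_mul_typeProd_shape` — the cofactor identity `ε^{μ_i} · G^S_{i+a}(ε) = P(i + ε) · G^T_i(ε)` (`μ_i = f(i+a) − e_i`);
* `frameRho_shape` — `ρ[G·Φ_S]_{i+a,σ} = ρ[G(·+a)·P·Φ_T]_{i,σ}` for every polynomial `G` and all `i ≤ L`, `σ`;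
* `frameWPoly_shape` — **`ŵ[G·Φ_S] = ŵ[G(·+a)·P·Φ_T]`** and `frameVPolySh_shape` — **`v̂^{(a)}[G·Φ_S] = v̂[G(·+a)·P·Φ_T]`**, where
  `frameVPolySh a` is the `v̂`-functional of `S` with the harmonic numbers taken at the SHIFTED levels `m − a` (the translation from
  `H_m` to `H_{m−a}` is done at class level, `FourthOrderBracket`);
* `shapePoly_monic`, `shapePoly_natDegree`, `padicNorm_shapePoly_coeff_le_one` (integer roots).
Pure power-series algebra over `ℚ`; nothing here bears on irrationality.
-/

noncomputable section

open Finset PowerSeries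

namespace Summit.KontsevichZagierPeriods.Zeta5Search.SecondOrder

open Summit.KontsevichZagierPeriods.Zeta5Search.ClusterValuation
open Summit.KontsevichZagierPeriods.Zeta5Search.PadicSeries
open Summit.KontsevichZagierPeriods.Zeta5Search.LevelClass (typeRho typeW typeV)
open Literature.NumberTheory.Transcendental.BallRivoal (harm)

variable {p : ℕ} [hp : Fact p.Prime]

/-! ## §1 Domination data and the shape polynomial -/

/-- The frame exponents moved to the core levels `a, …, a+L` of the shape (and `0` outside the core). -/
def coreExt (L a : ℕ) (e : ℕ → ℤ) : ℕ → ℤ := fun m => if a ≤ m ∧ m ≤ a + L then e (m - a) else 0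

/-- The raise multiplicity at the level `m` of the shape: `μ_m = f m − ẽ m` (a natural number under domination). -/
def raiseMult (L a : ℕ) (e f : ℕ → ℤ) (m : ℕ) : ℕ := (f m - coreExt L a e m).toNat

/-- **The shape polynomial** `P = ∏_{m ≤ L'} (X − (m − a))^{μ_m}` (T-coordinates: the core level `m` has coordinate `m − a`). -/
def shapePoly (L a L' : ℕ) (e f : ℕ → ℤ) : Polynomial ℚ :=
  ∏ m ∈ range (L' + 1), (Polynomial.X - Polynomial.C ((m : ℚ) - a)) ^ raiseMult L a e f m

/-- The `v̂`-functional of a type with the harmonic numbers taken at the levels SHIFTED down by `a`: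
`v̂^{(a)}[G·Φ_S] := Σ_{poles m} Σ_σ (−1)^σ ρ[GΦ_S]_{m,σ} H^{(σ)}_{m−a}`. -/
def frameVPolySh (a L : ℕ) (f : ℕ → ℤ) (G : Polynomial ℚ) : ℚ :=
  ∑ m ∈ (range (L + 1)).filter (fun m => f m < 0), ∑ σ ∈ Icc 1 (-f m).toNat,
    (-1 : ℚ) ^ σ * frameRho L f G m σ * harm σ (m - a)

omit hp in
/-- With offset `0` the shifted functional is the plain one. -/
theorem frameVPolySh_zero (L : ℕ) (f : ℕ → ℤ) (G : Polynomial ℚ) : frameVPolySh 0 L f G = frameVPoly L f G := by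
  unfold frameVPolySh frameVPoly; simp

omit hp in
/-- On the core, `ẽ (i + a) = e i`. -/
theorem coreExt_core (L a : ℕ) (e : ℕ → ℤ) {i : ℕ} (hi : i ≤ L) : coreExt L a e (i + a) = e i := by
  unfold coreExt; rw [if_pos ⟨by omega, by omega⟩, Nat.add_sub_cancel]

omit hp in
/-- Off the core, `ẽ m = 0`. -/
theorem coreExt_off (L a : ℕ) (e : ℕ → ℤ) {m : ℕ} (hm : m < a ∨ a + L < m) : coreExt L a e m = 0 := by
  unfold coreExt; rw [if_neg (by omega)]

/-! ## §2 The cofactor identity -/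

section Shape

variable {L a L' : ℕ} {e f : ℕ → ℤ} (hL' : a + L ≤ L') (hdom : ∀ m ≤ L', coreExt L a e m ≤ f m)
include hL' hdom

omit hp hL' in
/-- Under domination `f m = ẽ m + μ_m`. -/
theorem f_eq_coreExt_add (m : ℕ) (hm : m ≤ L') : f m = coreExt L a e m + (raiseMult L a e f m : ℕ) := by
  have h := hdom m hm
  unfold raiseMult
  omega

omit hp in
/-- **The cofactor identity**: `ε^{μ_{i+a}} · G^S_{i+a}(ε) = P(i + ε) · G^T_i(ε)` for `i ≤ L`. -/
theorem X_pow_mul_typeProd_shape {i : ℕ} (hi : i ≤ L) :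
    X ^ raiseMult L a e f (i + a) * typeProd L' f (i + a) = polyAtLevel (shapePoly L a L' e f) i * typeProd L e i := by
  have hia : i + a ≤ L' := by omega
  -- Step 1: split every factor of `G^S_{i+a}` into its raise part and its core part
  have hsplit : typeProd L' f (i + a) =
      (∏ m ∈ (range (L' + 1)).erase (i + a), (X + C (((i + a : ℕ) : ℚ) - m)) ^ raiseMult L a e f m) *
        ∏ m ∈ (range (L' + 1)).erase (i + a), binomSeries (((i + a : ℕ) : ℚ) - m) (coreExt L a e m) := by
    unfold typeProd
    rw [← prod_mul_distrib]
    refine prod_congr rfl fun m hm => ?_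
    obtain ⟨hmi, hmr⟩ := mem_erase.1 hm
    have hmL : m ≤ L' := by have := mem_range.1 hmr; omega
    have hδ : (((i + a : ℕ) : ℚ) - m) ≠ 0 := sub_ne_zero.2 (by exact_mod_cast (Ne.symm hmi))
    rw [f_eq_coreExt_add hdom m hmL, linS_pow_mul_binomSeries hδ]
  -- Step 2: the core part is `G^T_i`
  have hcore : ∏ m ∈ (range (L' + 1)).erase (i + a), binomSeries (((i + a : ℕ) : ℚ) - m) (coreExt L a e m) =
      typeProd L e i := by
    rw [← prod_filter_mul_prod_filter_not ((range (L' + 1)).erase (i + a)) (fun m => a ≤ m ∧ m ≤ a + L)]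
    have hoff : ∏ m ∈ ((range (L' + 1)).erase (i + a)).filter (fun m => ¬ (a ≤ m ∧ m ≤ a + L)),
        binomSeries (((i + a : ℕ) : ℚ) - m) (coreExt L a e m) = 1 :=
      prod_eq_one fun m hm => by
        rw [coreExt_off L a e (by have := (mem_filter.1 hm).2; omega), binomSeries_zero]
    have hset : ((range (L' + 1)).erase (i + a)).filter (fun m => a ≤ m ∧ m ≤ a + L) =
        ((range (L + 1)).erase i).image (fun j => j + a) := by
      ext m
      simp only [mem_filter, mem_erase, mem_range, mem_image]
      constructor
      · rintro ⟨⟨hne, hlt⟩, h1, h2⟩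
        exact ⟨m - a, ⟨by omega, by omega⟩, by omega⟩
      · rintro ⟨j, ⟨hj1, hj2⟩, rfl⟩
        exact ⟨⟨by omega, by omega⟩, by omega, by omega⟩
    rw [hoff, mul_one, hset, prod_image (fun x _ y _ h => by simpa using h)]
    unfold typeProd
    refine prod_congr rfl fun j hj => ?_
    have hjL : j ≤ L := by have := mem_range.1 (mem_erase.1 hj).2; omega
    rw [coreExt_core L a e hjL]
    congr 1
    push_cast; ring
  -- Step 3: the raise part times `ε^{μ_{i+a}}` is `P(i + ε)`
  have hP : polyAtLevel (shapePoly L a L' e f) i =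
      ∏ m ∈ range (L' + 1), (X + C (((i + a : ℕ) : ℚ) - m)) ^ raiseMult L a e f m := by
    unfold polyAtLevel shapePoly
    rw [Polynomial.prod_comp, ← Polynomial.coeToPowerSeries.ringHom_apply, map_prod]
    refine prod_congr rfl fun m _ => ?_
    rw [Polynomial.pow_comp, Polynomial.sub_comp, Polynomial.X_comp, Polynomial.C_comp, map_pow,
      Polynomial.coeToPowerSeries.ringHom_apply,
      show Polynomial.X + Polynomial.C (i : ℚ) - Polynomial.C ((m : ℚ) - a) =
        Polynomial.X + Polynomial.C (((i + a : ℕ) : ℚ) - m) by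
          rw [add_sub_assoc, ← Polynomial.C_sub]; congr 2; push_cast; ring,
      Polynomial.coe_add, Polynomial.coe_X, Polynomial.coe_C]
  have hself : (X + C (((i + a : ℕ) : ℚ) - ((i + a : ℕ) : ℚ))) ^ raiseMult L a e f (i + a) =
      (X : PowerSeries ℚ) ^ raiseMult L a e f (i + a) := by
    rw [sub_self, map_zero, add_zero]
  rw [hsplit, hcore, ← mul_assoc, hP, ← mul_prod_erase (range (L' + 1)) _ (mem_range.2 (by omega) : i + a ∈ range (L' + 1)),
    hself]

omit hp hL' hdom in
/-- `(G ∘ (· + a))(i + ε) = G(i + a + ε)`. -/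
theorem polyAtLevel_comp_shift (G : Polynomial ℚ) (a i : ℕ) :
    polyAtLevel (G.comp (Polynomial.X + Polynomial.C (a : ℚ))) i = polyAtLevel G (i + a) := by
  unfold polyAtLevel
  rw [Polynomial.comp_assoc, Polynomial.add_comp, Polynomial.X_comp, Polynomial.C_comp, add_assoc, ← Polynomial.C_add]
  congr 3; push_cast; ring

omit hp in
/-- **`ρ` transfer**: `ρ[G·Φ_S]_{i+a,σ} = ρ[G(·+a)·P·Φ_T]_{i,σ}` for `i ≤ L` and every `σ`. -/
theorem frameRho_shape (G : Polynomial ℚ) {i : ℕ} (hi : i ≤ L) (σ : ℕ) :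
    frameRho L' f G (i + a) σ =
      frameRho L e (G.comp (Polynomial.X + Polynomial.C (a : ℚ)) * shapePoly L a L' e f) i σ := by
  have hia : i + a ≤ L' := by omega
  have hμ : (raiseMult L a e f (i + a) : ℤ) = f (i + a) - e i := by
    have h := hdom (i + a) hia
    rw [coreExt_core L a e hi] at h
    unfold raiseMult; rw [coreExt_core L a e hi]; omega
  unfold frameRho
  rw [polyAtLevel_mul, polyAtLevel_comp_shift, mul_assoc, ← X_pow_mul_typeProd_shape hL' hdom hi, ← mul_assoc,
    mul_comm (polyAtLevel G (i + a)) (X ^ _), mul_assoc, coeff_X_pow_mul']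
  by_cases hσ : (σ : ℤ) ≤ -f (i + a)
  · rw [if_pos hσ, if_pos (by omega), if_pos (by omega),
      show (-f (i + a)).toNat - σ = (-e i).toNat - σ - raiseMult L a e f (i + a) by omega]
  · rw [if_neg hσ]
    by_cases hσ' : (σ : ℤ) ≤ -e i
    · rw [if_pos hσ', if_neg (by omega)]
    · rw [if_neg hσ']

omit hp hL' in
/-- Poles of the shape lie in the core. -/
theorem core_of_pole {m : ℕ} (hm : m ≤ L') (hneg : f m < 0) : a ≤ m ∧ m ≤ a + L := by
  by_contra h
  have := hdom m hm
  rw [coreExt_off L a e (by omega)] at this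
  omega

omit hp in
/-- **`ŵ` transfer**: `ŵ[G·Φ_S] = ŵ[G(·+a)·P·Φ_T]`. -/
theorem frameWPoly_shape (G : Polynomial ℚ) :
    frameWPoly L' f G = frameWPoly L e (G.comp (Polynomial.X + Polynomial.C (a : ℚ)) * shapePoly L a L' e f) := by
  unfold frameWPoly
  -- reindex the poles of `S` by core coordinates
  have hset : (range (L' + 1)).filter (fun m => f m < 0) =
      ((range (L + 1)).filter (fun i => f (i + a) < 0)).image (fun i => i + a) := by
    ext m
    simp only [mem_filter, mem_range, mem_image]
    constructor
    · rintro ⟨hm, hneg⟩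
      obtain ⟨h1, h2⟩ := core_of_pole hdom (by omega) hneg
      exact ⟨m - a, ⟨by omega, by rwa [Nat.sub_add_cancel h1]⟩, by omega⟩
    · rintro ⟨i, ⟨hi, hneg⟩, rfl⟩
      exact ⟨by omega, hneg⟩
  rw [hset, sum_image (fun x _ y _ h => by simpa using h)]
  -- the frame sum has more indices, but the extra terms vanish
  symm
  rw [← sum_filter_add_sum_filter_not ((range (L + 1)).filter (fun i => e i < 0)) (fun i => f (i + a) < 0)]
  have hzero : ∑ i ∈ ((range (L + 1)).filter (fun i => e i < 0)).filter (fun i => ¬ f (i + a) < 0),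
      frameRho L e (G.comp (Polynomial.X + Polynomial.C (a : ℚ)) * shapePoly L a L' e f) i 3 = 0 := by
    refine sum_eq_zero fun i hi => ?_
    obtain ⟨hi1, hnn⟩ := mem_filter.1 hi
    have hiL : i ≤ L := by have := mem_range.1 (mem_filter.1 hi1).1; omega
    rw [← frameRho_shape hL' hdom G hiL]
    unfold frameRho
    rw [if_neg (by push_cast; omega)]
  rw [hzero, add_zero]
  have hset2 : ((range (L + 1)).filter (fun i => e i < 0)).filter (fun i => f (i + a) < 0) =
      (range (L + 1)).filter (fun i => f (i + a) < 0) := by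
    ext i
    simp only [mem_filter, mem_range]
    constructor
    · rintro ⟨⟨h1, _⟩, h3⟩; exact ⟨h1, h3⟩
    · rintro ⟨h1, h3⟩
      refine ⟨⟨h1, ?_⟩, h3⟩
      have := hdom (i + a) (by omega)
      rw [coreExt_core L a e (by omega)] at this
      omega
  rw [hset2]
  exact sum_congr rfl fun i hi => (frameRho_shape hL' hdom G (by have := mem_range.1 (mem_filter.1 hi).1; omega) 3).symm

omit hp in
/-- **`v̂` transfer** (shifted harmonic levels): `v̂^{(a)}[G·Φ_S] = v̂[G(·+a)·P·Φ_T]`. -/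
theorem frameVPolySh_shape (G : Polynomial ℚ) :
    frameVPolySh a L' f G = frameVPoly L e (G.comp (Polynomial.X + Polynomial.C (a : ℚ)) * shapePoly L a L' e f) := by
  set GP := G.comp (Polynomial.X + Polynomial.C (a : ℚ)) * shapePoly L a L' e f with hGP
  unfold frameVPolySh frameVPoly
  have hset : (range (L' + 1)).filter (fun m => f m < 0) =
      ((range (L + 1)).filter (fun i => f (i + a) < 0)).image (fun i => i + a) := by
    ext m
    simp only [mem_filter, mem_range, mem_image]
    constructor
    · rintro ⟨hm, hneg⟩
      obtain ⟨h1, h2⟩ := core_of_pole hdom (by omega) hneg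
      exact ⟨m - a, ⟨by omega, by rwa [Nat.sub_add_cancel h1]⟩, by omega⟩
    · rintro ⟨i, ⟨hi, hneg⟩, rfl⟩
      exact ⟨by omega, hneg⟩
  rw [hset, sum_image (fun x _ y _ h => by simpa using h)]
  simp only [Nat.add_sub_cancel]
  symm
  rw [← sum_filter_add_sum_filter_not ((range (L + 1)).filter (fun i => e i < 0)) (fun i => f (i + a) < 0)]
  have hzero : ∑ i ∈ ((range (L + 1)).filter (fun i => e i < 0)).filter (fun i => ¬ f (i + a) < 0),
      ∑ σ ∈ Icc 1 (-e i).toNat, (-1 : ℚ) ^ σ * frameRho L e GP i σ * harm σ i = 0 := by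
    refine sum_eq_zero fun i hi => sum_eq_zero fun σ hσ => ?_
    obtain ⟨hi1, hnn⟩ := mem_filter.1 hi
    have hiL : i ≤ L := by have := mem_range.1 (mem_filter.1 hi1).1; omega
    have hσ1 := (mem_Icc.1 hσ).1
    rw [hGP, ← frameRho_shape hL' hdom G hiL]
    unfold frameRho
    rw [if_neg (by omega)]; ring
  rw [hzero, add_zero]
  have hset2 : ((range (L + 1)).filter (fun i => e i < 0)).filter (fun i => f (i + a) < 0) =
      (range (L + 1)).filter (fun i => f (i + a) < 0) := by
    ext i
    simp only [mem_filter, mem_range]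
    constructor
    · rintro ⟨⟨h1, _⟩, h3⟩; exact ⟨h1, h3⟩
    · rintro ⟨h1, h3⟩
      refine ⟨⟨h1, ?_⟩, h3⟩
      have := hdom (i + a) (by omega)
      rw [coreExt_core L a e (by omega)] at this
      omega
  rw [hset2]
  refine sum_congr rfl fun i hi => ?_
  have hiL : i ≤ L := by have := mem_range.1 (mem_filter.1 hi).1; omega
  have hle : (-f (i + a)).toNat ≤ (-e i).toNat := by
    have := hdom (i + a) (by omega)
    rw [coreExt_core L a e hiL] at this
    omega
  rw [show (∑ σ ∈ Icc 1 (-e i).toNat, (-1 : ℚ) ^ σ * frameRho L e GP i σ * harm σ i) =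
      ∑ σ ∈ Icc 1 (-e i).toNat, (-1 : ℚ) ^ σ * frameRho L' f G (i + a) σ * harm σ i from
    sum_congr rfl fun σ _ => by rw [hGP, frameRho_shape hL' hdom G hiL σ]]
  symm
  apply sum_subset
  · intro σ hσ
    rw [mem_Icc] at hσ ⊢; omega
  · intro σ hσ hσ'
    rw [mem_Icc] at hσ
    rw [mem_Icc, not_and_or] at hσ'
    unfold frameRho
    rw [if_neg (by omega)]; ring

omit hp hL' hdom in
/-- **The shape polynomial is monic.** -/
theorem shapePoly_monic : (shapePoly L a L' e f).Monic :=
  Polynomial.monic_prod_of_monic _ _ fun _ _ => (Polynomial.monic_X_sub_C _).pow _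

omit hp hL' hdom in
/-- **Degree of the shape polynomial** = total raise multiplicity. -/
theorem shapePoly_natDegree : (shapePoly L a L' e f).natDegree = ∑ m ∈ range (L' + 1), raiseMult L a e f m := by
  unfold shapePoly
  rw [Polynomial.natDegree_prod_of_monic _ _ fun _ _ => (Polynomial.monic_X_sub_C _).pow _]
  exact sum_congr rfl fun m _ => by rw [Polynomial.natDegree_pow, Polynomial.natDegree_X_sub_C, mul_one]

omit hL' hdom in
/-- **The shape polynomial has `p`-integral coefficients** (its roots are integers). -/
theorem padicNorm_shapePoly_coeff_le_one (k : ℕ) : padicNorm p ((shapePoly L a L' e f).coeff k) ≤ 1 := by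
  have hcoe : CoeffBound p 0 0 ((shapePoly L a L' e f : Polynomial ℚ) : PowerSeries ℚ) := by
    unfold shapePoly
    rw [← Polynomial.coeToPowerSeries.ringHom_apply, map_prod]
    have h := CoeffBound.prod (p := p) (r := 0) (range (L' + 1)) (fun _ => (0 : ℤ))
      (fun m => Polynomial.coeToPowerSeries.ringHom
        ((Polynomial.X - Polynomial.C ((m : ℚ) - a)) ^ raiseMult L a e f m)) fun m _ => ?_
    · simpa using h
    · rw [map_pow, Polynomial.coeToPowerSeries.ringHom_apply, sub_eq_add_neg, ← Polynomial.C_neg, Polynomial.coe_add,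
        Polynomial.coe_X, Polynomial.coe_C]
      have hlin : CoeffBound p 0 0 (X + C (-((m : ℚ) - a))) := by
        refine coeffBound_X_add_C le_rfl ?_
        rw [neg_zero, zpow_zero, padicNorm.neg, show ((m : ℚ) - a) = (((m : ℤ) - a : ℤ) : ℚ) by push_cast; ring]
        exact padicNorm.of_int _
      simpa using hlin.pow (raiseMult L a e f m)
  have := hcoe.norm_le_one k
  rwa [Polynomial.coeff_coe] at this

end Shape



end Summit.KontsevichZagierPeriods.Zeta5Search.SecondOrder

end
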